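import Summits.CriticalPhenomena.CardyFormulaZ2.Theses.CardySectorGap
import Literature.Probability.Percolation.SmirnovSeparatingData
import Literature.Probability.Percolation.UnionJackSeparating

/-!
# Birth skeleton of the crux `GsContourIdentity` (route CardySectorGap, item stmt-CriticalPhenomena-17674)

Smirnov's contour relation (36) for local-uniform scaling limits of the CANONICAL `G_s` separating
probabilities, cut along the seam the tree uses (and proves) for the triangular lattice
(`IsSeparatingData.cauchy` = Bollobás–Riordan Lemma 13, then the Riemann-sum passage of Claim 23):

* `stub_ujDiscreteCauchy` — THE KERNEL (Beffara 2008 §3–4, open): the discrete Cauchy estimate for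
  the canonical observables `ujSepProbFun (T n) (μ n) i` (read at the triangle containing a point),
  sampled along lattice-parallel equilateral contours of step `μ n` inside a compact `K ⊆ U`
  (the tree's `discreteTriangleIntegral`): `‖∮ᴰ f^(i+1) − ω ∮ᴰ f^i‖ ≤ N μ_n e_n`, `e_n → 0`.
  On `𝕋` this is Lemma 13 (summation by parts + colour switching + `ψ ≡ 0`); on `G_s` the same
  computation leaves Beffara's defect `Σ ψ(e) P_A(e)`, `ψ = (3−√3)/4·(1−i) ≠ 0` (`ujPsi_zero_one`),
  whose vanishing in the limit is the open problem.
* `stub_ujRiemannPassage` — ANALYSIS (provable, size M/L): centre-sampled local uniform convergence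
  of the canonical observables to a continuous `G` plus the sampled discrete Cauchy estimate give
  (36) for `G` (Riemann sums along `p → p + N s → p + N s ζ`, `N s → r`; the point-to-triangle map
  `ujFaceAt` is within one mesh of the identity; uniform continuity of `G` on a compact
  neighbourhood of the triangle).
* `GsContourIdentity_of` — the kernel-checked composition (real proof: the kept-coverage hypothesis
  of the kernel is extracted from the convergence clause of the crux).
-/

namespace Summit.CriticalPhenomena.CardyFormulaZ2.Cruxes.GsContourIdentity.Birth

open scoped Topology
open Filter Set
open Literature.Probability.Percolation Literature.Probability.RandomPlanarGeometry
open Literature.Probability.LatticeModels (triZeta)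

/-- KERNEL stub (Bollobás–Riordan Lemma 13 for `G_s`, sampled form; Beffara 2008 eq. (discr)):
the discrete Cauchy estimate for the canonical `G_s` separating probabilities of
orientation-certified 3-marked domains along lattice-parallel equilateral contours in compacts of
`U`. [cite: Beffara2008Universal, §3 eq. (discr)] [cite: BollobasRiordan2006, Ch. 7 Lemma 13 p. 181] -/
theorem stub_ujDiscreteCauchy : ∀ (U : Set ℂ), IsOpen U → ∀ (ω : ℂ) (T : ℕ → MarkedDomain 3), (∀ n, ∃ (a' b' c' : ℂ) (ψ' : ConformalEquiv (T n).carrier (openTriangle a' b' c')), IsEquilateral a' b' c' ∧ triangleTurn a' b' c' = ω ∧ ψ'.HasBoundaryValue ((T n).pt 0) a' ∧ ψ'.HasBoundaryValue ((T n).pt 1) b' ∧ ψ'.HasBoundaryValue ((T n).pt 2) c') → ∀ (μ : ℕ → ℝ), (∀ n, 0 < μ n) → Tendsto μ atTop (𝓝 0) → (∀ K : Set ℂ, IsCompact K → K ⊆ U → ∀ᶠ n in atTop, K ⊆ (T n).carrier) → (∀ K : Set ℂ, IsCompact K → K ⊆ U → ∀ᶠ n in atTop, ∀ t : UJFace, ((μ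 n : ℝ) : ℂ) * ujFaceCenter t ∈ K → t ∈ ujFaces (T n).carrier (μ n)) → (∀ K : Set ℂ, IsCompact K → K ⊆ U → ∃ e : ℕ → ℝ, Tendsto e atTop (𝓝 0) ∧ ∀ᶠ n in atTop, ∀ (i : Fin 3) (p : ℂ) (N : ℕ) (s : ℝ), (s = μ n ∨ s = -μ n) → convexHull ℝ {p, p + N * s, p + N * s * triZeta} ⊆ K → ‖discreteTriangleIntegral (ujSepProbFun (T n) (μ n) (i + 1)) p s N - ω * discreteTriangleIntegral (ujSepProbFun (T n) (μ n) i) p s N‖ ≤ N * μ n * e n) := by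
  sorry

/-- ANALYSIS stub (Bollobás–Riordan, proof of Claim 23, p. 199, for centre-sampled `G_s`
observables): sampled discrete Cauchy estimate + centre-sampled local uniform convergence to a
continuous `G` ⇒ the contour relation (36) for `G`. [cite: BollobasRiordan2006, Ch. 7 Claim 23 p. 199] -/
theorem stub_ujRiemannPassage : ∀ (U : Set ℂ), IsOpen U → ∀ (ω : ℂ) (T : ℕ → MarkedDomain 3) (μ : ℕ → ℝ), (∀ n, 0 < μ n) → Tendsto μ atTop (𝓝 0) → ∀ (G : Fin 3 → ℂ → ℝ), (∀ i, ContinuousOn (G i) U) → (∀ K : Set ℂ, IsCompact K → K ⊆ U → ∀ ε > (0 : ℝ), ∀ᶠ n in atTop, ∀ (i : Fin 3) (t : UJFace), ((μ n : ℝ) : ℂ) * ujFaceCenter t ∈ K → t ∈ ujFaces (T n).carrier (μ n) ∧ |ujSepProb (T n) (μ n) i t - G i (((μ n : ℝ) : ℂ) * ujFaceCenter t)| < ε) → (∀ K : Set ℂ, IsCompact K → K ⊆ U → ∃ e : ℕ → ℝ, Tendsto e atTop (𝓝 0) ∧ ∀ᶠ n in atTop, ∀ (i : Fin 3) (p : ℂ)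 (N : ℕ) (s : ℝ), (s = μ n ∨ s = -μ n) → convexHull ℝ {p, p + N * s, p + N * s * triZeta} ⊆ K → ‖discreteTriangleIntegral (ujSepProbFun (T n) (μ n) (i + 1)) p s N - ω * discreteTriangleIntegral (ujSepProbFun (T n) (μ n) i) p s N‖ ≤ N * μ n * e n) → ∀ (i : Fin 3) (p : ℂ) (r : ℝ), convexHull ℝ {p, p + r, p + r * triZeta} ⊆ U → triangleIntegral (fun w => (G (i + 1) w : ℂ) - ω * G i w) p (p + r) (p + r * triZeta) = 0 := by
  sorry

/-- Composition (hypothesis-free: the registered stubs are used BY NAME): the two stubs give the crux `GsContourIdentity` BY NAME. -/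
theorem GsContourIdentity_of :
    Summit.CriticalPhenomena.CardyFormulaZ2.Theses.CardySectorGap.GsContourIdentity := by
  have h1 := stub_ujDiscreteCauchy
  have h2 := stub_ujRiemannPassage
  intro U hU ω T hcert μ hμpos hμ0 G hGc hcontain hconv i p r hT
  have hkept : ∀ K : Set ℂ, IsCompact K → K ⊆ U → ∀ᶠ n in atTop, ∀ t : UJFace,
      ((μ n : ℝ) : ℂ) * ujFaceCenter t ∈ K → t ∈ ujFaces (T n).carrier (μ n) := by
    intro K hK hKU
    exact (hconv K hK hKU 1 one_pos).mono fun n hn t ht => (hn 0 t ht).1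
  exact h2 U hU ω T μ hμpos hμ0 G hGc hconv (h1 U hU ω T hcert μ hμpos hμ0 hcontain hkept) i p r hT

end Summit.CriticalPhenomena.CardyFormulaZ2.Cruxes.GsContourIdentity.Birth
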